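import Mathlib
import Summits.PneNP.PneNP.Theorems.OverlapGapAlgebraSolvableImpliesStableSectionFilteredRepairAsymptotics

/-!
# PneNP / OverlapGapAlgebra — crux `SolvableImpliesStableSection` (stmt-PneNP-2463):
# the FILTERED REPAIR block (6/7) — the mean bound is eventually below `2^{-k}(1 - e^{-λ}/2)`

Support for crux `stmt-PneNP-2463` (`Summit.PneNP.PneNP.Theses.OverlapGapAlgebra.SolvableImpliesStableSection`).
Pure real analysis.  With `X = (2n)^k`, `B_up = X - k(n+1)^{k-1}`, `B_t = X - t k n^{k-1}`,
`d = m2^{-k}/n`, `m = ⌊αn⌋` and `λ = kα2^{-k}`, the normalised mean bound of the filtered repair round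
`q = 2^{-k}(1 - (B_up/X)^{m-1}) + C(k,2) Σ_{r<k-1} C(k-2,r) [2^{-k} d^{r+2} (B_{r+2}/X)^{m-3-r} + (r+2)² m/(4^k n²)]`
is, for all large `n`, at most `2^{-k}(1 - e^{-λ}/2)` (`sissF_rates`): pointwise `q ≤ G(1/n)` for an
explicit continuous `G` (`sissF_q_le_G`: `(B_up/X)^{m-1} ≥ exp(-λ(1+1/n)^{k-1}(1+2c₁))` by
`log(1-c) ≥ -c/(1-c) ≥ -c(1+2c)`, `(B_t/X)^{m-1-t} ≤ exp(-tλ + kε/n)` by `1 - y ≤ e^{-y}`), and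
`G(0) = 2^{-k}θ < 2^{-k}(1 - e^{-λ}/2)` by `sissF_theta_lt`.
No new definitions; axioms `propext`, `Classical.choice`, `Quot.sound`.
-/

set_option linter.dupNamespace false -- `Summit.PneNP.PneNP.…`: summit = sub-problem (D-0017)

namespace Summit.PneNP.PneNP.Theorems

open Finset Filter
open scoped Classical Topology

section FilteredRepairRates

/-- `log (1 - c) ≥ -c(1 + 2c)` for `0 ≤ c ≤ 1/2`, in the form `(1-c)^M ≥ exp(-M c (1+2c))`. -/
theorem sissF_one_sub_pow_ge (c : ℝ) (hc : c ≤ 1 / 2) (M : ℕ) :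
    Real.exp (-(M * (c * (1 + 2 * c)))) ≤ (1 - c) ^ M := by
  have hpos : 0 < 1 - c := by linarith
  have hlog : -(c * (1 + 2 * c)) ≤ Real.log (1 - c) := by
    have h := Real.one_sub_inv_le_log_of_pos hpos
    have h2 : -(c * (1 + 2 * c)) ≤ 1 - (1 - c)⁻¹ := by
      rw [show (1 : ℝ) - (1 - c)⁻¹ = -(c / (1 - c)) by field_simp; ring]
      rw [neg_le_neg_iff, div_le_iff₀ hpos]
      nlinarith [mul_nonneg (sq_nonneg c) (show (0 : ℝ) ≤ 1 - 2 * c by linarith)]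
    linarith
  calc Real.exp (-(M * (c * (1 + 2 * c)))) = Real.exp (M * -(c * (1 + 2 * c))) := by ring_nf
    _ ≤ Real.exp (M * Real.log (1 - c)) :=
        Real.exp_le_exp.2 (mul_le_mul_of_nonneg_left hlog (Nat.cast_nonneg _))
    _ = (1 - c) ^ M := by rw [Real.exp_nat_mul, Real.exp_log hpos]

/-- `(1 - y)^M ≤ exp(-M y)` for `0 ≤ y ≤ 1`. -/
theorem sissF_one_sub_pow_le (y : ℝ) (hy : y ≤ 1) (M : ℕ) :
    (1 - y) ^ M ≤ Real.exp (-(M * y)) := by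
  have h := Real.add_one_le_exp (-y)
  calc (1 - y) ^ M ≤ Real.exp (-y) ^ M := pow_le_pow_left₀ (by linarith) (by linarith) M
    _ = Real.exp (-(M * y)) := by rw [← Real.exp_nat_mul]; ring_nf

/-- **Pointwise comparison `q ≤ G(1/n)`.** For `2 ≤ k ≤ n` and `k + 1 ≤ m ≤ αn` the normalised mean
bound is at most the value at `z = 1/n` of the explicit continuous function `G` of `sissF_rates`. -/
theorem sissF_q_le_G (k : ℕ) (hk2 : 2 ≤ k) (α : ℝ) (hα : 0 < α) (n m : ℕ) (hkn : k ≤ n)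
    (hm : k + 1 ≤ m) (hmα : (m : ℝ) ≤ α * n) (hmα' : α * n ≤ m + 1) :
    (1 / 2 : ℝ) ^ k * (1 - ((((2 * n) ^ k - k * (n + 1) ^ (k - 1) : ℕ) : ℝ) / (2 * (n : ℝ)) ^ k) ^ (m - 1))
      + (k.choose 2 : ℝ) * ∑ r ∈ range (k - 1), ((k - 2).choose r : ℝ) *
        ((1 / 2 : ℝ) ^ k * ((m : ℝ) * (1 / 2 : ℝ) ^ k / n) ^ (r + 2) *
            ((((2 * n) ^ k - (r + 2) * (k * n ^ (k - 1)) : ℕ) : ℝ) / (2 * (n : ℝ)) ^ k) ^ (m - 1 - (r + 2))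
          + ((r : ℝ) + 2) ^ 2 * m / (4 ^ k * n ^ 2))
    ≤ (1 / 2 : ℝ) ^ k * (1 - Real.exp (-((k * α * (1 / 2 : ℝ) ^ k) * (1 + 1 / (n : ℝ)) ^ (k - 1) *
          (1 + 2 * ((k : ℝ) * (1 / 2 : ℝ) ^ k * (1 + 1 / (n : ℝ)) ^ (k - 1) * (1 / (n : ℝ)))))))
      + (k.choose 2 : ℝ) * ∑ r ∈ range (k - 1), ((k - 2).choose r : ℝ) *
        ((1 / 2 : ℝ) ^ k * (α * (1 / 2 : ℝ) ^ k) ^ (r + 2) * Real.exp (-((r + 2 : ℕ) * (k * α * (1 / 2 : ℝ) ^ k)))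
            * Real.exp (k * ((k : ℝ) * (1 / 2 : ℝ) ^ k * (k + 2)) * (1 / (n : ℝ)))
          + ((r : ℝ) + 2) ^ 2 * (α / 4 ^ k) * (1 / (n : ℝ))) := by
  -- basic positivity
  have hk1 : 1 ≤ k := by omega
  have hn1 : 1 ≤ n := le_trans hk1 hkn
  have hnR : (1 : ℝ) ≤ n := by exact_mod_cast hn1
  have hn0 : (0 : ℝ) < n := by linarith
  have hkR : (k : ℝ) ≤ n := by exact_mod_cast hkn
  have hk2R : (2 : ℝ) ≤ k := by exact_mod_cast hk2
  have hX0 : (0 : ℝ) < (2 * (n : ℝ)) ^ k := by positivity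
  set L : ℝ := k * α * (1 / 2 : ℝ) ^ k with hL
  have hL0 : 0 < L := by positivity
  set c : ℝ := (1 / 2 : ℝ) ^ k with hc
  have hc0 : 0 < c := by positivity
  -- `k 2^{-k} ≤ 1` and `k² 2^{-k} ≤ k`
  have hkc : (k : ℝ) * c ≤ 1 := by
    rw [hc]
    have h2k : (k : ℝ) ≤ (2 : ℝ) ^ k := by
      have : k < 2 ^ k := Nat.lt_two_pow_self
      exact_mod_cast this.le
    have hp : (0 : ℝ) < (2 : ℝ) ^ k := by positivity
    rw [one_div_pow, ← div_eq_mul_one_div, div_le_one hp]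
    exact h2k
  -- the counts are exact (no truncation) for `k ≤ n`
  have hX_nat : (2 * n) ^ k = 2 ^ k * n ^ (k - 1) * n := by
    rw [mul_pow, mul_assoc, ← pow_succ, Nat.sub_add_cancel hk1]
  have hBup_le : k * (n + 1) ^ (k - 1) ≤ (2 * n) ^ k := by
    calc k * (n + 1) ^ (k - 1) ≤ (2 * n) * (2 * n) ^ (k - 1) := by
          refine Nat.mul_le_mul (by omega) (Nat.pow_le_pow_left (by omega) _)
      _ = (2 * n) ^ k := by rw [← pow_succ', Nat.sub_add_cancel hk1]
  have hBt_le : ∀ t : ℕ, t ≤ k → t * (k * n ^ (k - 1)) ≤ (2 * n) ^ k := by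
    intro t ht
    have h2k : k ≤ 2 ^ k := Nat.lt_two_pow_self.le
    calc t * (k * n ^ (k - 1)) ≤ k * (k * n ^ (k - 1)) := Nat.mul_le_mul_right _ ht
      _ = k * k * n ^ (k - 1) := by ring
      _ ≤ 2 ^ k * n * n ^ (k - 1) := Nat.mul_le_mul_right _ (Nat.mul_le_mul h2k hkn)
      _ = (2 * n) ^ k := by rw [hX_nat]; ring
  -- real forms of the two ratios
  have hXR : ((2 * n : ℕ) : ℝ) ^ k = (2 * (n : ℝ)) ^ k := by push_cast; ring
  have hρ₁ : (((2 * n) ^ k - k * (n + 1) ^ (k - 1) : ℕ) : ℝ) / (2 * (n : ℝ)) ^ k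
      = 1 - (k : ℝ) * c * (1 + 1 / (n : ℝ)) ^ (k - 1) * (1 / (n : ℝ)) := by
    rw [Nat.cast_sub hBup_le]
    push_cast
    rw [sub_div, div_self hX0.ne']
    congr 1
    rw [hc, show (1 : ℝ) + 1 / n = (n + 1) / n by field_simp, div_pow, div_pow, one_pow, mul_pow]
    have hnk : (n : ℝ) ^ k = (n : ℝ) ^ (k - 1) * n := by
      rw [← pow_succ, Nat.sub_add_cancel hk1]
    rw [hnk]
    field_simp
  have hρt : ∀ t : ℕ, t ≤ k → (((2 * n) ^ k - t * (k * n ^ (k - 1)) : ℕ) : ℝ) / (2 * (n : ℝ)) ^ k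
      = 1 - (t : ℝ) * ((k : ℝ) * c * (1 / (n : ℝ))) := by
    intro t ht
    rw [Nat.cast_sub (hBt_le t ht)]
    push_cast
    rw [sub_div, div_self hX0.ne']
    congr 1
    rw [hc, one_div_pow, mul_pow]
    have hnk : (n : ℝ) ^ k = (n : ℝ) ^ (k - 1) * n := by
      rw [← pow_succ, Nat.sub_add_cancel hk1]
    rw [hnk]
    field_simp
  -- sizes of `c₁ = k c (1+1/n)^{k-1}/n` and `c₀ = k c / n`
  set c₁ : ℝ := (k : ℝ) * c * (1 + 1 / (n : ℝ)) ^ (k - 1) * (1 / (n : ℝ)) with hc₁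
  have hc₁0 : 0 ≤ c₁ := by positivity
  have hc₁half : c₁ ≤ 1 / 2 := by
    -- `(1+1/n)^{k-1} ≤ 2^{k-1}`, `k c 2^{k-1} = k/2`, `k/(2n) ≤ 1/2`
    have h1 : (1 + 1 / (n : ℝ)) ^ (k - 1) ≤ (2 : ℝ) ^ (k - 1) := by
      refine pow_le_pow_left₀ (by positivity) ?_ _
      have : 1 / (n : ℝ) ≤ 1 := by rw [div_le_one hn0]; exact hnR
      linarith
    have h2 : c * (2 : ℝ) ^ (k - 1) = 1 / 2 := by
      rw [hc, one_div_pow]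
      have : (2 : ℝ) ^ k = 2 ^ (k - 1) * 2 := by rw [← pow_succ, Nat.sub_add_cancel hk1]
      rw [this]; field_simp
    calc c₁ ≤ (k : ℝ) * c * (2 : ℝ) ^ (k - 1) * (1 / (n : ℝ)) := by
          rw [hc₁]
          refine mul_le_mul_of_nonneg_right (mul_le_mul_of_nonneg_left h1 (by positivity)) (by positivity)
      _ = (k : ℝ) / n * (1 / 2) := by rw [mul_assoc (k : ℝ), h2]; ring
      _ ≤ 1 * (1 / 2) := by
          refine mul_le_mul_of_nonneg_right ?_ (by norm_num)
          rw [div_le_one hn0]; exact hkR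
      _ = 1 / 2 := one_mul _
  set c₀ : ℝ := (k : ℝ) * c * (1 / (n : ℝ)) with hc₀
  have hc₀0 : 0 ≤ c₀ := by positivity
  have hkc₀ : (k : ℝ) * c₀ ≤ 1 := by
    -- `k c₀ = k (k c)/n ≤ k/n ≤ 1`
    rw [hc₀]
    calc (k : ℝ) * ((k : ℝ) * c * (1 / (n : ℝ))) = ((k : ℝ) * c) * ((k : ℝ) / n) := by ring
      _ ≤ 1 * 1 := by
          refine mul_le_mul hkc ?_ (by positivity) zero_le_one
          rw [div_le_one hn0]; exact hkR
      _ = 1 := one_mul _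
  -- `m` versus `α n`
  have hm1 : (1 : ℝ) ≤ m := by
    have : 1 ≤ m := by omega
    exact_mod_cast this
  have hmR : ((m - 1 : ℕ) : ℝ) ≤ α * n := by
    rw [Nat.cast_sub (by omega)]; push_cast; linarith
  -- (i) the unsafe term
  have hT1 : 1 - ((((2 * n) ^ k - k * (n + 1) ^ (k - 1) : ℕ) : ℝ) / (2 * (n : ℝ)) ^ k) ^ (m - 1)
      ≤ 1 - Real.exp (-(L * (1 + 1 / (n : ℝ)) ^ (k - 1) * (1 + 2 * c₁))) := by
    rw [hρ₁]
    have h1 := sissF_one_sub_pow_ge c₁ hc₁half (m - 1)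
    have h2 : Real.exp (-(L * (1 + 1 / (n : ℝ)) ^ (k - 1) * (1 + 2 * c₁)))
        ≤ Real.exp (-(((m - 1 : ℕ) : ℝ) * (c₁ * (1 + 2 * c₁)))) := by
      refine Real.exp_le_exp.2 (neg_le_neg ?_)
      have hkey : ((m - 1 : ℕ) : ℝ) * c₁ ≤ L * (1 + 1 / (n : ℝ)) ^ (k - 1) := by
        calc ((m - 1 : ℕ) : ℝ) * c₁ ≤ α * n * c₁ := mul_le_mul_of_nonneg_right hmR hc₁0
          _ = L * (1 + 1 / (n : ℝ)) ^ (k - 1) := by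
              rw [hc₁, hL]; field_simp
      have h12 : (0 : ℝ) ≤ 1 + 2 * c₁ := by positivity
      calc ((m - 1 : ℕ) : ℝ) * (c₁ * (1 + 2 * c₁)) = ((m - 1 : ℕ) : ℝ) * c₁ * (1 + 2 * c₁) := by ring
        _ ≤ L * (1 + 1 / (n : ℝ)) ^ (k - 1) * (1 + 2 * c₁) := mul_le_mul_of_nonneg_right hkey h12
    have : c₁ = (k : ℝ) * c * (1 + 1 / (n : ℝ)) ^ (k - 1) * (1 / (n : ℝ)) := hc₁
    linarith [h1, h2]
  -- (ii) the injective-tuple terms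
  have hT2 : ∀ r ∈ range (k - 1),
      (1 / 2 : ℝ) ^ k * ((m : ℝ) * (1 / 2 : ℝ) ^ k / n) ^ (r + 2) *
          ((((2 * n) ^ k - (r + 2) * (k * n ^ (k - 1)) : ℕ) : ℝ) / (2 * (n : ℝ)) ^ k) ^ (m - 1 - (r + 2))
        ≤ (1 / 2 : ℝ) ^ k * (α * (1 / 2 : ℝ) ^ k) ^ (r + 2) * Real.exp (-((r + 2 : ℕ) * L))
            * Real.exp (k * ((k : ℝ) * c * (k + 2)) * (1 / (n : ℝ))) := by
    intro r hr
    have hrk : r + 2 ≤ k := by have := mem_range.1 hr; omega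
    have hrkR : ((r + 2 : ℕ) : ℝ) ≤ k := by exact_mod_cast hrk
    rw [hρt (r + 2) hrk]
    -- `d ≤ α c`
    have hd0 : (0 : ℝ) ≤ (m : ℝ) * (1 / 2 : ℝ) ^ k / n := by positivity
    have hd : (m : ℝ) * (1 / 2 : ℝ) ^ k / n ≤ α * (1 / 2 : ℝ) ^ k := by
      rw [div_le_iff₀ hn0]
      calc (m : ℝ) * (1 / 2 : ℝ) ^ k ≤ α * n * (1 / 2 : ℝ) ^ k :=
            mul_le_mul_of_nonneg_right hmα (by positivity)
        _ = α * (1 / 2 : ℝ) ^ k * n := by ring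
    have hdpow : ((m : ℝ) * (1 / 2 : ℝ) ^ k / n) ^ (r + 2) ≤ (α * (1 / 2 : ℝ) ^ k) ^ (r + 2) :=
      pow_le_pow_left₀ hd0 hd _
    -- `(1 - t c₀)^{m-1-t} ≤ exp(-t c₀ (m-1-t)) ≤ exp(-t L + k ε / n)`
    have hy0 : 0 ≤ ((r + 2 : ℕ) : ℝ) * c₀ := by positivity
    have hy1 : ((r + 2 : ℕ) : ℝ) * c₀ ≤ 1 := le_trans (mul_le_mul_of_nonneg_right hrkR hc₀0) hkc₀
    have hpow := sissF_one_sub_pow_le _ hy1 (m - 1 - (r + 2))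
    have hexp : Real.exp (-(((m - 1 - (r + 2) : ℕ) : ℝ) * (((r + 2 : ℕ) : ℝ) * c₀)))
        ≤ Real.exp (-((r + 2 : ℕ) * L)) * Real.exp (k * ((k : ℝ) * c * (k + 2)) * (1 / (n : ℝ))) := by
      rw [← Real.exp_add]
      refine Real.exp_le_exp.2 ?_
      have hM : α * n - 2 - k ≤ ((m - 1 - (r + 2) : ℕ) : ℝ) := by
        rw [Nat.cast_sub (by omega), Nat.cast_sub (by omega)]
        push_cast
        have hr2 : (r : ℝ) + 2 ≤ k := by exact_mod_cast hrk
        linarith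
      -- `c₀ (α n - 2 - k) = L - k c (k+2)/n`
      have hc₀L : c₀ * (α * n) = L := by rw [hc₀, hL]; field_simp
      have key : L - (k : ℝ) * c * (k + 2) * (1 / (n : ℝ)) = c₀ * (α * n - 2 - k) := by
        rw [← hc₀L, hc₀]; ring
      have hstep : ((r + 2 : ℕ) : ℝ) * (L - (k : ℝ) * c * (k + 2) * (1 / (n : ℝ)))
          ≤ ((m - 1 - (r + 2) : ℕ) : ℝ) * (((r + 2 : ℕ) : ℝ) * c₀) := by
        rw [key]
        calc ((r + 2 : ℕ) : ℝ) * (c₀ * (α * n - 2 - k)) = ((r + 2 : ℕ) : ℝ) * c₀ * (α * n - 2 - k) := by ring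
          _ ≤ ((r + 2 : ℕ) : ℝ) * c₀ * ((m - 1 - (r + 2) : ℕ) : ℝ) := mul_le_mul_of_nonneg_left hM hy0
          _ = _ := by ring
      have hE0 : (0 : ℝ) ≤ (k : ℝ) * c * (k + 2) * (1 / (n : ℝ)) := by positivity
      have hkε : ((r + 2 : ℕ) : ℝ) * ((k : ℝ) * c * (k + 2) * (1 / (n : ℝ)))
          ≤ k * ((k : ℝ) * c * (k + 2)) * (1 / (n : ℝ)) := by
        calc ((r + 2 : ℕ) : ℝ) * ((k : ℝ) * c * (k + 2) * (1 / (n : ℝ)))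
            ≤ (k : ℝ) * ((k : ℝ) * c * (k + 2) * (1 / (n : ℝ))) := mul_le_mul_of_nonneg_right hrkR hE0
          _ = _ := by ring
      linarith [hstep, hkε]
    have hA0 : (0 : ℝ) ≤ (1 / 2 : ℝ) ^ k * ((m : ℝ) * (1 / 2 : ℝ) ^ k / n) ^ (r + 2) := by positivity
    calc (1 / 2 : ℝ) ^ k * ((m : ℝ) * (1 / 2 : ℝ) ^ k / n) ^ (r + 2) *
          (1 - ((r + 2 : ℕ) : ℝ) * ((k : ℝ) * c * (1 / (n : ℝ)))) ^ (m - 1 - (r + 2))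
        ≤ (1 / 2 : ℝ) ^ k * ((m : ℝ) * (1 / 2 : ℝ) ^ k / n) ^ (r + 2) *
          (Real.exp (-((r + 2 : ℕ) * L)) * Real.exp (k * ((k : ℝ) * c * (k + 2)) * (1 / (n : ℝ)))) :=
          mul_le_mul_of_nonneg_left (hpow.trans hexp) hA0
      _ ≤ (1 / 2 : ℝ) ^ k * (α * (1 / 2 : ℝ) ^ k) ^ (r + 2) *
          (Real.exp (-((r + 2 : ℕ) * L)) * Real.exp (k * ((k : ℝ) * c * (k + 2)) * (1 / (n : ℝ)))) := by
          refine mul_le_mul_of_nonneg_right (mul_le_mul_of_nonneg_left hdpow (by positivity)) ?_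
          positivity
      _ = _ := by ring
  -- (iii) the coincidence terms
  have hT3 : ∀ r ∈ range (k - 1),
      ((r : ℝ) + 2) ^ 2 * m / (4 ^ k * n ^ 2) ≤ ((r : ℝ) + 2) ^ 2 * (α / 4 ^ k) * (1 / (n : ℝ)) := by
    intro r _
    rw [div_le_iff₀ (by positivity)]
    have h4 : (0 : ℝ) < 4 ^ k := by positivity
    have : ((r : ℝ) + 2) ^ 2 * (α / 4 ^ k) * (1 / (n : ℝ)) * (4 ^ k * n ^ 2) = ((r : ℝ) + 2) ^ 2 * (α * n) := by
      field_simp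
    rw [this]
    exact mul_le_mul_of_nonneg_left hmα (by positivity)
  -- assemble
  have hC2 : (0 : ℝ) ≤ (k.choose 2 : ℝ) := Nat.cast_nonneg _
  refine add_le_add (mul_le_mul_of_nonneg_left hT1 hc0.le) (mul_le_mul_of_nonneg_left ?_ hC2)
  refine sum_le_sum fun r hr => mul_le_mul_of_nonneg_left ?_ (Nat.cast_nonneg _)
  exact add_le_add (hT2 r hr) (hT3 r hr)

/-- **The mean bound is eventually below the target.** For `k ≥ 2` and `α > 0`, for all large `n`
and `m = ⌊αn⌋`: `k + 1 ≤ m`, and the normalised mean bound `q(k, m, n)` of the filtered repair round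
(with the actual counts) is at most `2^{-k}(1 - e^{-kα2^{-k}}/2)`. -/
theorem sissF_rates (k : ℕ) (hk2 : 2 ≤ k) (α : ℝ) (hα : 0 < α) :
    ∀ᶠ n : ℕ in atTop, ∀ m : ℕ, m = ⌊α * n⌋₊ → k + 1 ≤ m ∧
      (1 / 2 : ℝ) ^ k * (1 - ((((2 * n) ^ k - k * (n + 1) ^ (k - 1) : ℕ) : ℝ) / (2 * (n : ℝ)) ^ k) ^ (m - 1))
        + (k.choose 2 : ℝ) * ∑ r ∈ range (k - 1), ((k - 2).choose r : ℝ) *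
          ((1 / 2 : ℝ) ^ k * ((m : ℝ) * (1 / 2 : ℝ) ^ k / n) ^ (r + 2) *
              ((((2 * n) ^ k - (r + 2) * (k * n ^ (k - 1)) : ℕ) : ℝ) / (2 * (n : ℝ)) ^ k) ^ (m - 1 - (r + 2))
            + ((r : ℝ) + 2) ^ 2 * m / (4 ^ k * n ^ 2))
      ≤ (1 / 2 : ℝ) ^ k * (1 - Real.exp (-(k * α * (1 / 2 : ℝ) ^ k)) / 2) := by
  have hk0 : (0 : ℝ) < k := by exact_mod_cast (show 0 < k by omega)
  set L : ℝ := k * α * (1 / 2 : ℝ) ^ k with hL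
  have hL0 : 0 < L := by positivity
  -- the comparison function
  obtain ⟨G, hG⟩ : ∃ G : ℝ → ℝ, ∀ z, G z =
      (1 / 2 : ℝ) ^ k * (1 - Real.exp (-((k * α * (1 / 2 : ℝ) ^ k) * (1 + z) ^ (k - 1) *
          (1 + 2 * ((k : ℝ) * (1 / 2 : ℝ) ^ k * (1 + z) ^ (k - 1) * z)))))
      + (k.choose 2 : ℝ) * ∑ r ∈ range (k - 1), ((k - 2).choose r : ℝ) *
        ((1 / 2 : ℝ) ^ k * (α * (1 / 2 : ℝ) ^ k) ^ (r + 2) * Real.exp (-((r + 2 : ℕ) * (k * α * (1 / 2 : ℝ) ^ k)))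
            * Real.exp (k * ((k : ℝ) * (1 / 2 : ℝ) ^ k * (k + 2)) * z)
          + ((r : ℝ) + 2) ^ 2 * (α / 4 ^ k) * z) := ⟨fun z => _, fun z => rfl⟩
  have hGc : Continuous G := by
    have : G = fun z => (1 / 2 : ℝ) ^ k * (1 - Real.exp (-((k * α * (1 / 2 : ℝ) ^ k) * (1 + z) ^ (k - 1) *
          (1 + 2 * ((k : ℝ) * (1 / 2 : ℝ) ^ k * (1 + z) ^ (k - 1) * z)))))
      + (k.choose 2 : ℝ) * ∑ r ∈ range (k - 1), ((k - 2).choose r : ℝ) *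
        ((1 / 2 : ℝ) ^ k * (α * (1 / 2 : ℝ) ^ k) ^ (r + 2) * Real.exp (-((r + 2 : ℕ) * (k * α * (1 / 2 : ℝ) ^ k)))
            * Real.exp (k * ((k : ℝ) * (1 / 2 : ℝ) ^ k * (k + 2)) * z)
          + ((r : ℝ) + 2) ^ 2 * (α / 4 ^ k) * z) := funext hG
    rw [this]
    fun_prop
  -- its value at `0`
  have hG0 : G 0 = (1 / 2 : ℝ) ^ k * ((1 - Real.exp (-L)) + (k.choose 2 : ℝ) *
      ∑ r ∈ range (k - 1), ((k - 2).choose r : ℝ) * ((L / k) ^ (r + 2) * Real.exp (-((r + 2 : ℕ) * L)))) := by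
    rw [hG]
    have hαc : α * (1 / 2 : ℝ) ^ k = L / k := by
      rw [hL]; field_simp
    simp only [add_zero, mul_zero, one_pow, mul_one, Real.exp_zero, hαc]
    rw [mul_add, mul_sum, mul_sum, mul_sum]
    congr 1
    refine sum_congr rfl fun r _ => ?_
    ring
  -- the limit is below the target
  have hlt : G 0 < (1 / 2 : ℝ) ^ k * (1 - Real.exp (-L) / 2) := by
    rw [hG0]
    exact mul_lt_mul_of_pos_left (sissF_theta_lt k hk2 L hL0) (by positivity)
  have hlim : Tendsto (fun n : ℕ => G (1 / (n : ℝ))) atTop (𝓝 (G 0)) :=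
    (hGc.tendsto 0).comp tendsto_one_div_atTop_nhds_zero_nat
  have h1 : ∀ᶠ n : ℕ in atTop, G (1 / (n : ℝ)) ≤ (1 / 2 : ℝ) ^ k * (1 - Real.exp (-L) / 2) :=
    hlim.eventually_le_const hlt
  have h2 : ∀ᶠ n : ℕ in atTop, k ≤ n := eventually_ge_atTop k
  have h3 : ∀ᶠ n : ℕ in atTop, (k : ℝ) + 2 ≤ α * n :=
    (tendsto_natCast_atTop_atTop.const_mul_atTop hα).eventually_ge_atTop _
  filter_upwards [h1, h2, h3] with n hGn hkn hαn m hm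
  have hmα : (m : ℝ) ≤ α * n := by rw [hm]; exact Nat.floor_le (by positivity)
  have hmα' : α * n ≤ m + 1 := by rw [hm]; exact (Nat.lt_floor_add_one _).le
  have hkm : k + 1 ≤ m := by
    have : ((k + 1 : ℕ) : ℝ) ≤ m := by push_cast; linarith
    exact_mod_cast this
  refine ⟨hkm, ?_⟩
  have hq := sissF_q_le_G k hk2 α hα n m hkn hkm hmα hmα'
  rw [hG] at hGn
  exact hq.trans hGn

end FilteredRepairRates

end Summit.PneNP.PneNP.Theorems
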